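import Literature.Barriers.MatrixMultiplication.UnstableTensorBarrierThm17
import HarnessLib

/-!
# Proof of Bläser–Lysikov 2020, Theorem 16, and of the catalogue entry `UnstableTensorBarrier`

Topic `Literature/Barriers/MatrixMultiplication`; DISCHARGE of the named facts
`BlaserLysikov2020_thm16` and `UnstableTensorBarrier` (= Thm. 16 ∧ Thm. 17) of
`UnstableTensorBarrier.lean`. Everything here is PROVED.

Thm. 16 ("it is impossible to prove `ω = 2` from powers of unstable concise tensors with bounded
`N(t)`", vendored as `∀ n, ∃ B > 1, ∀` unstable concise `t` of format `≤ n × n × n`,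
`B · log Q̃(t) ≤ log R̃(t)`) is derived here from the explicit Thm. 17
(`BlaserLysikov2020_thm17_holds`) with `B(n) := B₁₇(max n 2)`,
`B₁₇(N) = (1 - 3^{-3N}/(18N⁴ ln N))⁻¹` — the printed proof instead takes the minimum of finitely
many ratios (finiteness of entanglement polytopes); the explicit constant serves as well:

* cubic formats `N × N × N`, `2 ≤ N ≤ n`: Thm. 17 at `N` and `B₁₇` is decreasing in `N`
  (`blBound_antitone`);
* non-cubic formats with all sides `≥ 1`: `Q̃(t) ≤ min side ≤ N - 1` and `R̃(t) ≥ N = max side`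
  (flattenings, `asymptoticSubrank_le_card₁₂₃`, `IsConcise.card_le_asymptoticRank`), and
  `B₁₇(N) log(N-1) ≤ log N` (`blBound_mul_log_pred_le`);
* degenerate formats: a concise tensor with an empty side has all sides empty
  (`IsConcise.isEmpty_all`), and then `Q̃ = R̃ = 0`; on a `1 × 1 × 1` format `SL₁³` is trivial, so an
  unstable tensor is `0`, not concise (`eq_zero_of_isUnstable_of_card_eq_one`).

## References

* M. Bläser, V. Lysikov, MFCS 2020, LIPIcs 170, 17, Thm. 16 (p. 8), Thm. 17, Prop. 15, §2.2.
  [BlaserLysikov2020]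
-/

noncomputable section

open scoped BigOperators

namespace Literature.Barriers.MatrixMultiplication

open Literature.Computability.AlgebraicComplexity

universe u

/-! ## The constant `B₁₇(N)` is decreasing and beats the flattening gap -/

section Constant

/-- `B₁₇(N) = (1 - 3^{-3N}/(18N⁴ ln N))⁻¹` is decreasing in `N ≥ 2`. [folklore] -/
theorem blBound_antitone {N N' : ℕ} (hN : 2 ≤ N) (hNN' : N ≤ N') :
    (1 - (3 : ℝ) ^ (-(3 * (N' : ℝ))) / (18 * (N' : ℝ) ^ 4 * Real.log N'))⁻¹ ≤
      (1 - (3 : ℝ) ^ (-(3 * (N : ℝ))) / (18 * (N : ℝ) ^ 4 * Real.log N))⁻¹ := by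
  have hN2 : (2 : ℝ) ≤ N := by exact_mod_cast hN
  have hNN : (N : ℝ) ≤ N' := by exact_mod_cast hNN'
  have hlogN : 0 < Real.log N := Real.log_pos (by linarith)
  have hlogN' : Real.log N ≤ Real.log N' := Real.log_le_log (by linarith) hNN
  have hden := blBound_denom_pos hN
  have hden' := blBound_denom_pos (hN.trans hNN')
  -- `ε(N') ≤ ε(N)`
  have hε : (3 : ℝ) ^ (-(3 * (N' : ℝ))) / (18 * (N' : ℝ) ^ 4 * Real.log N') ≤
      (3 : ℝ) ^ (-(3 * (N : ℝ))) / (18 * (N : ℝ) ^ 4 * Real.log N) := by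
    have h1 : (3 : ℝ) ^ (-(3 * (N' : ℝ))) ≤ (3 : ℝ) ^ (-(3 * (N : ℝ))) :=
      Real.rpow_le_rpow_of_exponent_le (by norm_num) (by linarith)
    have h2 : 18 * (N : ℝ) ^ 4 * Real.log N ≤ 18 * (N' : ℝ) ^ 4 * Real.log N' := by
      have hp : (N : ℝ) ^ 4 ≤ (N' : ℝ) ^ 4 := pow_le_pow_left₀ (by linarith) hNN 4
      have : (0 : ℝ) ≤ (N' : ℝ) ^ 4 := by positivity
      nlinarith
    exact div_le_div₀ (Real.rpow_nonneg (by norm_num) _) h1 (by positivity) h2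
  rw [inv_le_inv₀ hden' hden]
  linarith

/-- `B₁₇(N) · log(N-1) ≤ log N` for `N ≥ 2` (the flattening gap of a non-cubic format beats the
explicit constant: `3^{-3N}/(18N⁴) ≤ 1/N ≤ log(N/(N-1))`). [folklore] -/
theorem blBound_mul_log_pred_le {N : ℕ} (hN : 2 ≤ N) :
    (1 - (3 : ℝ) ^ (-(3 * (N : ℝ))) / (18 * (N : ℝ) ^ 4 * Real.log N))⁻¹ * Real.log ((N : ℝ) - 1) ≤
      Real.log N := by
  have hN2 : (2 : ℝ) ≤ N := by exact_mod_cast hN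
  have hNpos : (0 : ℝ) < N := by linarith
  have hlogN : 0 < Real.log N := Real.log_pos (by linarith)
  have hden := blBound_denom_pos hN
  set ε : ℝ := (3 : ℝ) ^ (-(3 * (N : ℝ))) / (18 * (N : ℝ) ^ 4 * Real.log N) with hε
  -- `ε log N ≤ 1/N ≤ log N - log (N-1)`
  have h1 : ε * Real.log N ≤ 1 / N := by
    have hpow : (3 : ℝ) ^ (-(3 * (N : ℝ))) ≤ 1 :=
      Real.rpow_le_one_of_one_le_of_nonpos (by norm_num) (by linarith)
    have hpow0 : 0 ≤ (3 : ℝ) ^ (-(3 * (N : ℝ))) := Real.rpow_nonneg (by norm_num) _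
    have heq : ε * Real.log N = (3 : ℝ) ^ (-(3 * (N : ℝ))) / (18 * (N : ℝ) ^ 4) := by
      rw [hε]
      field_simp
    rw [heq, div_le_div_iff₀ (by positivity) hNpos]
    have hN4 : (N : ℝ) ≤ (N : ℝ) ^ 4 := le_self_pow₀ (by linarith) (by norm_num)
    have hN18 : (N : ℝ) ≤ 18 * (N : ℝ) ^ 4 := by nlinarith
    have := mul_le_mul_of_nonneg_right hpow hNpos.le
    nlinarith
  have h2 : 1 / (N : ℝ) ≤ Real.log N - Real.log ((N : ℝ) - 1) := by
    have hpos : (0 : ℝ) < (N : ℝ) / ((N : ℝ) - 1) := div_pos hNpos (by linarith)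
    have h := Real.one_sub_inv_le_log_of_pos hpos
    rw [Real.log_div hNpos.ne' (by linarith), inv_div] at h
    have : 1 - ((N : ℝ) - 1) / N = 1 / N := by field_simp; ring
    linarith
  have hlog1 : 0 ≤ Real.log ((N : ℝ) - 1) := Real.log_nonneg (by linarith)
  rw [inv_mul_le_iff₀ hden]
  nlinarith

end Constant

/-! ## Degenerate formats -/

section Degenerate

variable {ι κ μ : Type} [Fintype ι] [Fintype κ] [Fintype μ]

omit [Fintype ι] [Fintype κ] [Fintype μ] in
/-- A concise tensor with one empty index set has all three index sets empty (a linearly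
independent family in the zero space is empty). [folklore] -/
theorem IsConcise.isEmpty_all {t : ι → κ → μ → ℂ} (h : IsConcise t)
    (h0 : IsEmpty ι ∨ IsEmpty κ ∨ IsEmpty μ) : IsEmpty ι ∧ IsEmpty κ ∧ IsEmpty μ := by
  have hB : IsEmpty ι → IsEmpty κ := fun hι => by
    haveI := hι
    exact ⟨fun b => h.2.1.ne_zero b (Subsingleton.elim _ _)⟩
  have hC : IsEmpty ι → IsEmpty μ := fun hι => by
    haveI := hι
    exact ⟨fun c => h.2.2.ne_zero c (Subsingleton.elim _ _)⟩
  have hA₁ : IsEmpty κ → IsEmpty ι := fun hκ => by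
    haveI := hκ
    exact ⟨fun a => h.1.ne_zero a (Subsingleton.elim _ _)⟩
  have hA₂ : IsEmpty μ → IsEmpty ι := fun hμ => by
    haveI := hμ
    exact ⟨fun a => h.1.ne_zero a (Subsingleton.elim _ _)⟩
  rcases h0 with hι | hκ | hμ
  · exact ⟨hι, hB hι, hC hι⟩
  · exact ⟨hA₁ hκ, hB (hA₁ hκ), hC (hA₁ hκ)⟩
  · exact ⟨hA₂ hμ, hB (hA₂ hμ), hC (hA₂ hμ)⟩

/-- On a format with empty first index set, `Q̃ = 0` (every power has an empty index set, so its
subrank is `0`). [folklore] -/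
theorem asymptoticSubrank_eq_zero_of_isEmpty [IsEmpty ι] (t : ι → κ → μ → ℂ) :
    asymptoticSubrank ℂ t = 0 := by
  unfold asymptoticSubrank
  have h : ∀ N : ℕ, ((subrank ℂ (kroneckerPow t (N + 1)) : ℝ) ^ ((N : ℝ) + 1)⁻¹) = 0 := by
    intro N
    have hQ : subrank ℂ (kroneckerPow t (N + 1)) = 0 := by
      have := subrank_kroneckerPow_le_card_pow (K := ℂ) t (N + 1)
      rw [Fintype.card_eq_zero, zero_pow (Nat.succ_ne_zero N)] at this
      exact Nat.le_zero.1 this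
    rw [hQ, Nat.cast_zero, Real.zero_rpow]
    exact inv_ne_zero (by positivity)
  simp_rw [h]
  exact ciSup_const

/-- On a format with empty first index set, `R̃ = 0` (`R̃(t) ≤ R(t^{⊗1}) = R(0) = 0`). [folklore] -/
theorem asymptoticRank_eq_zero_of_isEmpty [IsEmpty ι] (t : ι → κ → μ → ℂ) :
    asymptoticRank t = 0 := by
  refine le_antisymm ?_ (asymptoticRank_nonneg t)
  have h0 : kroneckerPow t 1 = 0 := funext fun a => isEmptyElim (a 0)
  have h := asymptoticRank_le_tensorRank_pow_one t
  rw [h0, tensorRank_zero, Nat.cast_zero] at h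
  exact h

variable [DecidableEq ι] [DecidableEq κ] [DecidableEq μ]

/-- On a `1 × 1 × 1` format the group `SL₁ × SL₁ × SL₁` is trivial, so an unstable tensor is `0`.
[folklore] -/
theorem eq_zero_of_isUnstable_of_card_eq_one {t : ι → κ → μ → ℂ} (hι : Fintype.card ι = 1)
    (hκ : Fintype.card κ = 1) (hμ : Fintype.card μ = 1) (hu : IsUnstable t) : t = 0 := by
  have h1 : ∀ {X : Type} [Fintype X] [DecidableEq X], Fintype.card X = 1 →
      ∀ g : Matrix.SpecialLinearGroup X ℂ, (g : Matrix X X ℂ) = 1 := by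
    intro X _ _ hX g
    haveI : Subsingleton X := Fintype.card_le_one_iff_subsingleton.1 hX.le
    ext i j
    obtain rfl : i = j := Subsingleton.elim _ _
    have hdet : Matrix.det (g : Matrix X X ℂ) = (g : Matrix X X ℂ) i i :=
      Matrix.det_eq_elem_of_subsingleton _ i
    rw [Matrix.one_apply_eq, ← hdet]
    exact Matrix.SpecialLinearGroup.det_coe g
  unfold IsUnstable at hu
  have hrange : Set.range (fun g : Matrix.SpecialLinearGroup ι ℂ × Matrix.SpecialLinearGroup κ ℂ ×
      Matrix.SpecialLinearGroup μ ℂ =>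
        actTensor (g.1 : Matrix ι ι ℂ) (g.2.1 : Matrix κ κ ℂ) (g.2.2 : Matrix μ μ ℂ) t) = {t} := by
    ext s
    simp only [Set.mem_range, Set.mem_singleton_iff]
    constructor
    · rintro ⟨g, rfl⟩
      rw [h1 hι g.1, h1 hκ g.2.1, h1 hμ g.2.2, actTensor_one]
    · rintro rfl
      exact ⟨1, by rw [h1 hι, h1 hκ, h1 hμ, actTensor_one]⟩
  rw [hrange, closure_singleton, Set.mem_singleton_iff] at hu
  exact hu.symm

end Degenerate

/-! ## The discharges -/

section Discharge

/-- The finishing step common to all non-degenerate formats: from `2 ≤ M ≤ N₀`, `M ≤ R̃(t)` and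
`B₁₇(M) log Q̃ ≤ log R̃` conclude `B₁₇(N₀) log Q̃ ≤ log R̃`. [folklore] -/
theorem blBound_mul_log_le_of_le {M N₀ : ℕ} (hM : 2 ≤ M) (hMN : M ≤ N₀) {Q R : ℝ}
    (hR : (M : ℝ) ≤ R)
    (h : (1 - (3 : ℝ) ^ (-(3 * (M : ℝ))) / (18 * (M : ℝ) ^ 4 * Real.log M))⁻¹ * Real.log Q ≤
      Real.log R) :
    (1 - (3 : ℝ) ^ (-(3 * (N₀ : ℝ))) / (18 * (N₀ : ℝ) ^ 4 * Real.log N₀))⁻¹ * Real.log Q ≤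
      Real.log R := by
  have hM2 : (2 : ℝ) ≤ M := by exact_mod_cast hM
  have hlogR : 0 ≤ Real.log R := by
    have : Real.log M ≤ Real.log R := Real.log_le_log (by linarith) hR
    have : 0 < Real.log M := Real.log_pos (by linarith)
    linarith
  have hB0 : 0 < (1 - (3 : ℝ) ^ (-(3 * (N₀ : ℝ))) / (18 * (N₀ : ℝ) ^ 4 * Real.log N₀))⁻¹ :=
    inv_pos.2 (blBound_denom_pos (hM.trans hMN))
  by_cases hq : Real.log Q ≤ 0
  · have := mul_nonpos_of_nonneg_of_nonpos hB0.le hq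
    linarith
  · rw [not_le] at hq
    exact (mul_le_mul_of_nonneg_right (blBound_antitone hM hMN) hq.le).trans h

/-- **Bläser–Lysikov 2020, Theorem 16** (discharge of `BlaserLysikov2020_thm16`): for every `n`
there is `B > 1` — here `B = B₁₇(max n 2)` — with `B · log Q̃(t) ≤ log R̃(t)` for every unstable
concise tensor of format at most `n × n × n` over `ℂ`; hence (BL Thm. 7 = CVZ Thm. 9) no bound
`ω < 2B` from powers of such tensors. [cite: BlaserLysikov2020, Thm. 16] -/
theorem BlaserLysikov2020_thm16_holds : BlaserLysikov2020_thm16 := by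
  intro n
  refine ⟨(1 - (3 : ℝ) ^ (-(3 * ((max n 2 : ℕ) : ℝ))) /
      (18 * ((max n 2 : ℕ) : ℝ) ^ 4 * Real.log (max n 2 : ℕ)))⁻¹,
    one_lt_blaserLysikovBound (le_max_right n 2), ?_⟩
  intro ι κ μ _ _ _ _ _ _ hι hκ hμ t hu hc
  -- degenerate formats: an empty side
  by_cases h0 : IsEmpty ι ∨ IsEmpty κ ∨ IsEmpty μ
  · obtain ⟨hιe, -, -⟩ := hc.isEmpty_all h0
    rw [asymptoticSubrank_eq_zero_of_isEmpty, asymptoticRank_eq_zero_of_isEmpty, Real.log_zero,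
      mul_zero]
  have hιn : Nonempty ι := not_isEmpty_iff.1 fun h => h0 (Or.inl h)
  have hκn : Nonempty κ := not_isEmpty_iff.1 fun h => h0 (Or.inr (Or.inl h))
  have hμn : Nonempty μ := not_isEmpty_iff.1 fun h => h0 (Or.inr (Or.inr h))
  have hι1 : 1 ≤ Fintype.card ι := Fintype.card_pos
  have hκ1 : 1 ≤ Fintype.card κ := Fintype.card_pos
  have hμ1 : 1 ≤ Fintype.card μ := Fintype.card_pos
  have hQ := asymptoticSubrank_le_card₁₂₃ t
  have hR := hc.card_le_asymptoticRank
  have hQ0 := asymptoticSubrank_nonneg' t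
  -- the largest side `M`
  set M : ℕ := max (Fintype.card ι) (max (Fintype.card κ) (Fintype.card μ)) with hMdef
  have hMn : M ≤ n := max_le hι (max_le hκ hμ)
  have hMN : M ≤ max n 2 := hMn.trans (le_max_left n 2)
  have hRM : (M : ℝ) ≤ asymptoticRank t := by
    rcases le_total (Fintype.card ι) (max (Fintype.card κ) (Fintype.card μ)) with h | h
    · rw [hMdef, max_eq_right h]
      rcases le_total (Fintype.card κ) (Fintype.card μ) with h' | h'
      · rw [max_eq_right h']; exact hR.2.2
      · rw [max_eq_left h']; exact hR.2.1
    · rw [hMdef, max_eq_left h]; exact hR.1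
  by_cases hcube : Fintype.card ι = Fintype.card κ ∧ Fintype.card κ = Fintype.card μ
  · -- cubic format `M × M × M`
    obtain ⟨h12, h23⟩ := hcube
    have hMι : Fintype.card ι = M := by rw [hMdef, ← h23, ← h12, max_self, max_self]
    rcases (show M = 1 ∨ 2 ≤ M by omega) with hM1 | hM2
    · -- `1 × 1 × 1`: an unstable tensor is `0`, not concise
      exfalso
      have ht0 := eq_zero_of_isUnstable_of_card_eq_one (hMι.trans hM1)
        ((h12.symm.trans hMι).trans hM1) ((h23.symm.trans (h12.symm.trans hMι)).trans hM1) hu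
      exact hc.ne_zero ht0
    · exact blBound_mul_log_le_of_le hM2 hMN hRM
        (BlaserLysikov2020_thm17_holds M hM2 hMι (h12.symm.trans hMι)
          (h23.symm.trans (h12.symm.trans hMι)) t hu hc)
  · -- non-cubic: `Q̃ ≤ M - 1`, `R̃ ≥ M`, `M ≥ 2`
    have hmin : asymptoticSubrank ℂ t ≤ (M : ℝ) - 1 ∧ 2 ≤ M := by
      -- some side is `< M`
      have hlt : Fintype.card ι < M ∨ Fintype.card κ < M ∨ Fintype.card μ < M := by
        by_contra hall
        simp only [not_or, not_lt] at hall
        have hι' : Fintype.card ι = M := le_antisymm (le_max_left _ _) hall.1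
        have hκ' : Fintype.card κ = M :=
          le_antisymm ((le_max_left _ _).trans (le_max_right _ _)) hall.2.1
        have hμ' : Fintype.card μ = M :=
          le_antisymm ((le_max_right _ _).trans (le_max_right _ _)) hall.2.2
        exact hcube ⟨hι'.trans hκ'.symm, hκ'.trans hμ'.symm⟩
      rcases hlt with h | h | h
      · refine ⟨hQ.1.trans ?_, by omega⟩
        have : (Fintype.card ι : ℝ) + 1 ≤ M := by exact_mod_cast h
        linarith
      · refine ⟨hQ.2.1.trans ?_, by omega⟩
        have : (Fintype.card κ : ℝ) + 1 ≤ M := by exact_mod_cast h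
        linarith
      · refine ⟨hQ.2.2.trans ?_, by omega⟩
        have : (Fintype.card μ : ℝ) + 1 ≤ M := by exact_mod_cast h
        linarith
    obtain ⟨hQM, hM2⟩ := hmin
    have hM2r : (2 : ℝ) ≤ M := by exact_mod_cast hM2
    refine blBound_mul_log_le_of_le hM2 hMN hRM ?_
    -- `B₁₇(M) log Q̃ ≤ B₁₇(M) log (M-1) ≤ log M ≤ log R̃`
    have hlogQ : Real.log (asymptoticSubrank ℂ t) ≤ Real.log ((M : ℝ) - 1) := by
      rcases hQ0.eq_or_lt with hq0 | hqpos
      · rw [← hq0, Real.log_zero]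
        exact Real.log_nonneg (by linarith)
      · exact Real.log_le_log hqpos hQM
    have hBpos : 0 < (1 - (3 : ℝ) ^ (-(3 * (M : ℝ))) / (18 * (M : ℝ) ^ 4 * Real.log M))⁻¹ :=
      inv_pos.2 (blBound_denom_pos hM2)
    have hlogR : Real.log M ≤ Real.log (asymptoticRank t) := Real.log_le_log (by linarith) hRM
    calc (1 - (3 : ℝ) ^ (-(3 * (M : ℝ))) / (18 * (M : ℝ) ^ 4 * Real.log M))⁻¹ *
          Real.log (asymptoticSubrank ℂ t)
        ≤ (1 - (3 : ℝ) ^ (-(3 * (M : ℝ))) / (18 * (M : ℝ) ^ 4 * Real.log M))⁻¹ *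
          Real.log ((M : ℝ) - 1) := mul_le_mul_of_nonneg_left hlogQ hBpos.le
      _ ≤ Real.log M := blBound_mul_log_pred_le hM2
      _ ≤ Real.log (asymptoticRank t) := hlogR

/-- **The catalogue entry `UnstableTensorBarrier` holds** (Bläser–Lysikov 2020, Thm. 16 ∧ Thm. 17):
unstable concise tensors over `ℂ` are irreversible, uniformly in bounded size and with the explicit
bound of Thm. 17. [cite: BlaserLysikov2020, Thm. 16 and Thm. 17] -/
theorem UnstableTensorBarrier_holds : UnstableTensorBarrier :=
  ⟨BlaserLysikov2020_thm16_holds, BlaserLysikov2020_thm17_holds⟩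

end Discharge

end Literature.Barriers.MatrixMultiplication

end
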